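import Summits.NavierStokesRegularity.FluidComputer.GateBudgetColdOutput
import HarnessLib

/-!
# What no tuning can beat, part 41: THE SECOND IGNITION OF A LATTICE DUD — its re-lit trigger
# fires a second pulse at `r₁ ≈ 3√2`, of duration `≤ 242/K⁹`, with the clock re-armed at
# `b(r₁) ≥ 1.39ε` and `99.3 %` of the energy still in the carrier

Cell `pub-fluidc`, blueprint seat bp1 (gen 33, second item, first half); same namespace and
conventions as parts 1–40 (`GateBudget*.lean`); imports part 40 (`GateBudgetColdOutput`, and
through it parts 38 `GateBudgetSharpRefire`, 22 `GateBudgetComb`, 21 `GateBudgetHeadline`, 18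
`GateBudgetPulseWindow`, 16 `GateBudgetPinnedPhase`). Modes `0 = a` carrier, `1 = b` clock,
`2 = c` trigger (`u = c/ρ²`), `3 = d` transfer, `4 = ã` output; `w = ε/(K¹⁰ρ²)`;
`t₋ = √(2 - 24 log K/K¹⁰)`, `t₊ = √(2 + 2/K¹⁰) + 242/K⁹`. HONEST FRAMING (verbatim): low prior,
high value-of-information experiment on Tao's machine paradigm; NOT a claim that NS blows up.
Nothing is proved about the Navier–Stokes equations.

THE POINT (SPEC-INPUT-bp1 §AN item (19b), THE SECOND PULSE'S TRANSFER, first half). Part 38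
followed a LATTICE dud (`ε = kK¹⁰ρ²`) through its cold window to the RE-LIGHT time `r₁ ∈ (T +
2.8282, T + 2.8542)` where the trigger is back at `ρ²/K⁹` with the clock re-armed (`b ≥
0.993ε(r - t_z)`, so `b(r₁) ≥ 1.39ε`) and the carrier still holding `a² ≥ 0.993`. The first-pulse
machinery of parts 16 and 18 is stated from a GENERAL entry time `s₀`; this part supplies the
numerics at the late entry time and re-enters part 18 at `s₀ = r₁`:
* §125 numerics (`r₁ + 1/16 ≤ 4.47`): part 18's time budget with `H = 1/16`, `β = ε/4`,
  `γ = 13ε/20`, entry = exit level `K⁻¹⁰` is `≤ 8 log(9εK¹⁰/ρ²)/K¹⁰ + 200/(169K¹⁰ - 400) ≤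
  242/K⁹` (part 21's `headline_delta` at `ρhi = 5ρ/6`); the LATTICE PHASE BUDGET from `r₁` (swing
  defect `arctan(2ρ²/(εK⁹)) + arctan(4λ₀ρ²/ε)`, critical ratio `100/(49K¹⁰)`, NO pre-entry dose —
  the entry trigger `ρ²/K⁹` costs `2/K¹⁹`, inside the first pulse's dose slot `3/(2K¹⁰)`) is below
  part 22's `teeth_psi` budget, hence `≤ 7/100`; and the algebra turning part 16's two-sided
  bracket into a pin `|Φ - wπ| ≤ w(η + (πq + D)/(1 - q))`;
* §126 `knob_dud_second_ignition`: part 18's `knob_pulse_window` at `s₀ = r₁` — a SECOND DOUSING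
  TIME `T₂` with `r₁ < T₂ ≤ r₁ + 242/K⁹`, trigger lit and `b² + c² ≥ (7ε/10)²` on `[r₁, T₂]`,
  `b(T₂) ≤ -ε/4`, `c(T₂) ≤ (K⁻¹⁰ + 4e^{-K¹⁰}/K¹⁰)ρ² ≤ 2ρ²/K¹⁰`, with the entry data `b(r₁) ≥
  1.39ε`, `c(r₁) = ρ²/K⁹`, `a(r₁)² ≥ 0.993` and the output growth `ã(T₂) ≤ ã(r₁) + K(T₂ - r₁)`.
Part 42 (`GateBudgetSecondPulse`) pins the second pulse's phase to `kπ ± 7/100` with these.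

READING. A lattice dud of Tao's gate family at `M = K¹⁰` re-fires near `3√2` and its second pulse
has the same duration bound `242/K⁹` and the same phase budget `7/100` as the first. HONEST
LIMITS. (i) LATTICE members only — off the lattice the re-fire time is open (§AN (19c)); (ii) only
`b(T₂) ≤ -ε/4` is recorded at the second dousing, not the sharp `-√2ε` of part 38 (a second cold
window would need parts 31–33 re-based at `T₂`); (iii) `M = K¹⁰`, `K ≥ 16`, window `200ε/K²⁰ ≤
ρ² ≤ 2ε/K¹⁰`, `ε² ≤ 1/(6K²⁰)`; (iv) nothing about Navier–Stokes.
[cite: Tao2016AveragedNS, §5.5 Theorem 5.3, (5.5), (5.6), (b-eq), (c-eq), (tcable)]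
-/

noncomputable section

namespace Summit.NavierStokesRegularity.FluidComputer.GateBudget

open Real Set Filter Topology
open Literature.Analysis.FluidPDE.Tao2016AveragedNS

variable {K ε ρ : ℝ} {X : ℝ → Fin 5 → ℝ} {C : ℝ → ℝ}

/-! ## §125 The numerics of the second ignition (`M = K¹⁰`, entry time `≤ 4.4`) -/

/-- **The time budget at a late entry.** `K ≥ 16`, `0 < ε`, `0 < ρ`, `200ε/K²⁰ ≤ ρ²`, entry time
`0 ≤ s ≤ 4.4`: part 18's budget with `H = 1/16`, `β = ε/4`, `γ = 13ε/20`, `λ₁ = λ = K⁻¹⁰` is at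
most `242/K⁹` — `2ε(s + 1/16)K¹⁰/ρ² ≤ 9εK¹⁰/ρ²` and part 21's `headline_delta` at `ρhi = 5ρ/6`.
[cite: Tao2016AveragedNS, §5.5 Theorem 5.3, (b-eq), (c-eq)] -/
theorem second_budget (hK : 16 ≤ K) (hε : 0 < ε) (hρ : 0 < ρ) (hlo : 200 * ε / K ^ 20 ≤ ρ ^ 2)
    {s : ℝ} (hs0 : 0 ≤ s) (hs : s ≤ 44 / 10) :
    ε * log (2 * ε * (s + 1 / 16) / (1 / K ^ 10 * ρ ^ 2)) / (K ^ 10 * (ε / 4))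
      + 2 * ε * (ε / 4) / (K ^ 10 * (13 / 20 * ε) ^ 2 - ε ^ 2)
      + ε * log (2 * ε * (s + 1 / 16) / (1 / K ^ 10 * ρ ^ 2)) / (K ^ 10 * (ε / 4))
      ≤ 242 / K ^ 9 := by
  have hK0 : 0 < K := by linarith
  have hK10 : 0 < K ^ 10 := by positivity
  have hρ2 : 0 < ρ ^ 2 := by positivity
  have hε2 : 0 < ε ^ 2 := by positivity
  have h10 : (1099511627776 : ℝ) ≤ K ^ 10 := by
    have := headline_pow_floor hK 10; norm_num at this; exact this
  have hden : 0 < K ^ 10 * (13 / 20 * ε) ^ 2 - ε ^ 2 := by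
    rw [show K ^ 10 * (13 / 20 * ε) ^ 2 - ε ^ 2 = 169 / 400 * (K ^ 10 * ε ^ 2) - ε ^ 2 by ring]
    nlinarith
  have hΔB : 2 * ε * (ε / 4) / (K ^ 10 * (13 / 20 * ε) ^ 2 - ε ^ 2)
      = 200 / (169 * K ^ 10 - 400) := by
    rw [div_eq_div_iff hden.ne' (by linarith : (0:ℝ) < 169 * K ^ 10 - 400).ne']
    ring
  have hid : ε * log (2 * ε * (s + 1 / 16) / (1 / K ^ 10 * ρ ^ 2)) / (K ^ 10 * (ε / 4))
      = 4 * (log (2 * ε * (s + 1 / 16) / (1 / K ^ 10 * ρ ^ 2)) / K ^ 10) := by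
    field_simp
  have hx : 2 * ε * (s + 1 / 16) / (1 / K ^ 10 * ρ ^ 2)
      ≤ 25 * ε * K ^ 10 / (4 * (5 / 6 * ρ) ^ 2) := by
    rw [show 2 * ε * (s + 1 / 16) / (1 / K ^ 10 * ρ ^ 2)
        = 2 * (s + 1 / 16) * (ε * K ^ 10 / ρ ^ 2) by field_simp,
      show 25 * ε * K ^ 10 / (4 * (5 / 6 * ρ) ^ 2) = 9 * (ε * K ^ 10 / ρ ^ 2) by
        field_simp; ring]
    exact mul_le_mul_of_nonneg_right (by linarith) (by positivity)
  have hlog := log_le_log (by positivity) hx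
  have h8 : 8 * (log (2 * ε * (s + 1 / 16) / (1 / K ^ 10 * ρ ^ 2)) / K ^ 10)
      ≤ 8 * (log (25 * ε * K ^ 10 / (4 * (5 / 6 * ρ) ^ 2)) / K ^ 10) :=
    mul_le_mul_of_nonneg_left (div_le_div_of_nonneg_right hlog hK10.le) (by norm_num)
  have hlo' : 20 * ε / K ^ 20 ≤ (5 / 6 * ρ) ^ 2 := by
    have hA : 0 ≤ 200 * ε / K ^ 20 := by positivity
    rw [show 20 * ε / K ^ 20 = 200 * ε / K ^ 20 * (1 / 10) by ring]
    nlinarith [hlo, hA]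
  have hd := headline_delta hK hε hlo'
  rw [mul_div_assoc] at hd
  rw [hΔB, hid]
  linarith

/-- **From a bracket to a pin (algebra).** `0 ≤ w`, `0 ≤ η`, `0 ≤ D`, `0 ≤ q < 1`,
`w(π - η - D) ≤ Φ ≤ w(π + D)/(1 - q)` give `|Φ - wπ| ≤ w(η + (πq + D)/(1 - q))` — the shape of part
16's `knob_phase_bracket` read as a pin around the winding `wπ`, with no pre-entry dose.
[cite: Tao2016AveragedNS, §5.5 Theorem 5.3, (b-eq)] -/
theorem pin_of_bracket {w η D q Φ : ℝ} (hw : 0 ≤ w) (hη : 0 ≤ η) (hD : 0 ≤ D) (hq0 : 0 ≤ q)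
    (hq1 : q < 1) (hlo : w * (π - η - D) ≤ Φ) (hhi : Φ ≤ w * (π + D) / (1 - q)) :
    |Φ - w * π| ≤ w * (η + (π * q + D) / (1 - q)) := by
  have h1q : 0 < 1 - q := by linarith
  have hex : D ≤ (π * q + D) / (1 - q) := by
    rw [le_div_iff₀ h1q]
    nlinarith [mul_nonneg hD hq0, mul_nonneg pi_pos.le hq0]
  have hup : w * (π + D) / (1 - q) = w * π + w * ((π * q + D) / (1 - q)) := by
    field_simp
    ring
  rw [hup] at hhi
  rw [abs_le]
  constructor
  · nlinarith [mul_le_mul_of_nonneg_left hex hw, mul_nonneg hw hη]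
  · nlinarith [mul_nonneg hw hη]

/-- **The lattice phase budget of the second pulse.** On the lattice `ε = kK¹⁰ρ²`, with `K ≥ 16`
and `0 ≤ τ ≤ Δ`: `k` times (swing defect `arctan((ρ²/K⁹)/(ε/2)) + arctan(λ₀ρ²/(ε/4))`,
`λ₀ = K⁻¹⁰ + 4e^{-K¹⁰}/K¹⁰`, plus the excess `(π·100/(49K¹⁰) + ρ²e^{-K¹⁰}τ/(7ε/10))/(1 -
100/(49K¹⁰))` of the critical ratio `q = 100/(49K¹⁰)`) is at most part 22's budget
`6/(K¹⁰K¹⁰) + 16e^{-K¹⁰}/(K¹⁰)² + (2ε/(K¹⁰ρ²)·π·100/(49K¹⁰) + 10e^{-K¹⁰}Δ/(7K¹⁰))/(1 -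
100/(49K¹⁰)) + 3/(2K¹⁰)` (`arctan x ≤ x`, `kρ² = ε/K¹⁰`, `k ≤ 2ε/(K¹⁰ρ²)`; the entry trigger
`ρ²/K⁹` costs `2/K¹⁹ ≤ 3/(2K¹⁰)`, the slot of the first pulse's pre-entry dose).
[cite: Tao2016AveragedNS, §5.5 Theorem 5.3, (b-eq), (c-eq)] -/
theorem second_psi_le {τ Δ : ℝ} (k : ℕ) (hk : ε = k * K ^ 10 * ρ ^ 2) (hε : 0 < ε)
    (hρ : 0 < ρ) (hK : 16 ≤ K) (hτ : τ ≤ Δ) :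
    k * (arctan (ρ ^ 2 / K ^ 9 / (ε / 2))
        + arctan ((1 / K ^ 10 + 4 * exp (-K ^ 10) / K ^ 10) * ρ ^ 2 / (ε / 4))
        + (π * (ε ^ 2 / (K ^ 10 * (7 / 10 * ε) ^ 2))
            + ρ ^ 2 * exp (-K ^ 10) * τ / (7 / 10 * ε))
          / (1 - ε ^ 2 / (K ^ 10 * (7 / 10 * ε) ^ 2)))
      ≤ 6 / (K ^ 10 * K ^ 10) + 16 * exp (-K ^ 10) / (K ^ 10) ^ 2
        + (2 * ε / (K ^ 10 * ρ ^ 2) * (π * (100 / (49 * K ^ 10)))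
            + 10 * exp (-K ^ 10) * Δ / (7 * K ^ 10)) / (1 - 100 / (49 * K ^ 10))
        + 3 / (2 * K ^ 10) := by
  have harc : ∀ {x : ℝ}, 0 ≤ x → arctan x ≤ x := fun {x} hx => by
    have h := Real.le_tan (Real.arctan_nonneg.2 hx) (Real.arctan_lt_pi_div_two x)
    rwa [Real.tan_arctan] at h
  have hK0 : 0 < K := by linarith
  have hK9 : 0 < K ^ 9 := by positivity
  have hK10 : 0 < K ^ 10 := by positivity
  have h9 : (68719476736 : ℝ) ≤ K ^ 9 := by
    have := headline_pow_floor hK 9; norm_num at this; exact this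
  have h10 : (1099511627776 : ℝ) ≤ K ^ 10 := by
    have := headline_pow_floor hK 10; norm_num at this; exact this
  have hk0 : (0 : ℝ) ≤ k := Nat.cast_nonneg k
  have heM : 0 < exp (-K ^ 10) := exp_pos _
  -- the lattice identity `kρ² = ε/K¹⁰`, `k ≤ 2ε/(K¹⁰ρ²)`, the critical ratio `100/(49K¹⁰)`
  have hkρ : (k : ℝ) * ρ ^ 2 = ε / K ^ 10 := by
    rw [eq_div_iff hK10.ne']; rw [hk]; ring
  have hκ : (k : ℝ) ≤ 2 * ε / (K ^ 10 * ρ ^ 2) := by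
    rw [le_div_iff₀ (by positivity), hk]; nlinarith [sq_nonneg ρ, hk0]
  have hq : ε ^ 2 / (K ^ 10 * (7 / 10 * ε) ^ 2) = 100 / (49 * K ^ 10) := by
    field_simp; ring
  rw [hq]
  have hq1 : 0 < 1 - 100 / (49 * K ^ 10) := by
    rw [sub_pos, div_lt_one (by positivity)]; linarith
  -- the two arctangents
  have h1 : (k : ℝ) * arctan (ρ ^ 2 / K ^ 9 / (ε / 2)) ≤ 2 / (K ^ 10 * K ^ 9) := by
    have hx : 0 ≤ ρ ^ 2 / K ^ 9 / (ε / 2) := by positivity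
    calc (k : ℝ) * arctan (ρ ^ 2 / K ^ 9 / (ε / 2))
        ≤ k * (ρ ^ 2 / K ^ 9 / (ε / 2)) := mul_le_mul_of_nonneg_left (harc hx) hk0
      _ = 2 * (k * ρ ^ 2) / (ε * K ^ 9) := by field_simp
      _ = 2 / (K ^ 10 * K ^ 9) := by rw [hkρ]; field_simp
  have h2 : (k : ℝ) * arctan ((1 / K ^ 10 + 4 * exp (-K ^ 10) / K ^ 10) * ρ ^ 2 / (ε / 4))
      ≤ 4 / (K ^ 10 * K ^ 10) + 16 * exp (-K ^ 10) / (K ^ 10) ^ 2 := by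
    have hx : 0 ≤ (1 / K ^ 10 + 4 * exp (-K ^ 10) / K ^ 10) * ρ ^ 2 / (ε / 4) := by
      positivity
    calc (k : ℝ) * arctan ((1 / K ^ 10 + 4 * exp (-K ^ 10) / K ^ 10) * ρ ^ 2 / (ε / 4))
        ≤ k * ((1 / K ^ 10 + 4 * exp (-K ^ 10) / K ^ 10) * ρ ^ 2 / (ε / 4)) :=
          mul_le_mul_of_nonneg_left (harc hx) hk0
      _ = 4 * (1 / K ^ 10 + 4 * exp (-K ^ 10) / K ^ 10) * (k * ρ ^ 2) / ε := by field_simp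
      _ = 4 / (K ^ 10 * K ^ 10) + 16 * exp (-K ^ 10) / (K ^ 10) ^ 2 := by
          rw [hkρ]; field_simp; ring
  -- the drift term: `k` cancels
  have h3 : (k : ℝ) * (ρ ^ 2 * exp (-K ^ 10) * τ / (7 / 10 * ε))
      ≤ 10 * exp (-K ^ 10) * Δ / (7 * K ^ 10) := by
    calc (k : ℝ) * (ρ ^ 2 * exp (-K ^ 10) * τ / (7 / 10 * ε))
        = 10 * exp (-K ^ 10) * τ * (k * ρ ^ 2) / (7 * ε) := by field_simp
      _ = 10 * exp (-K ^ 10) * τ / (7 * K ^ 10) := by rw [hkρ]; field_simp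
      _ ≤ 10 * exp (-K ^ 10) * Δ / (7 * K ^ 10) := by
          apply div_le_div_of_nonneg_right _ (by positivity)
          exact mul_le_mul_of_nonneg_left hτ (by positivity)
  have h4 : (k : ℝ) * (π * (100 / (49 * K ^ 10)))
      ≤ 2 * ε / (K ^ 10 * ρ ^ 2) * (π * (100 / (49 * K ^ 10))) :=
    mul_le_mul_of_nonneg_right hκ (by positivity)
  have hsplit : (k : ℝ) * (arctan (ρ ^ 2 / K ^ 9 / (ε / 2))
        + arctan ((1 / K ^ 10 + 4 * exp (-K ^ 10) / K ^ 10) * ρ ^ 2 / (ε / 4))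
        + (π * (100 / (49 * K ^ 10)) + ρ ^ 2 * exp (-K ^ 10) * τ / (7 / 10 * ε))
          / (1 - 100 / (49 * K ^ 10)))
      = k * arctan (ρ ^ 2 / K ^ 9 / (ε / 2))
        + k * arctan ((1 / K ^ 10 + 4 * exp (-K ^ 10) / K ^ 10) * ρ ^ 2 / (ε / 4))
        + (k * (π * (100 / (49 * K ^ 10))) + k * (ρ ^ 2 * exp (-K ^ 10) * τ / (7 / 10 * ε)))
          / (1 - 100 / (49 * K ^ 10)) := by ring
  rw [hsplit]
  have h5 : ((k : ℝ) * (π * (100 / (49 * K ^ 10)))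
        + k * (ρ ^ 2 * exp (-K ^ 10) * τ / (7 / 10 * ε))) / (1 - 100 / (49 * K ^ 10))
      ≤ (2 * ε / (K ^ 10 * ρ ^ 2) * (π * (100 / (49 * K ^ 10)))
        + 10 * exp (-K ^ 10) * Δ / (7 * K ^ 10)) / (1 - 100 / (49 * K ^ 10)) :=
    div_le_div_of_nonneg_right (by linarith) hq1.le
  -- the entry trigger's `2/K¹⁹` fits the dose slot `3/(2K¹⁰)`
  have h6 : (2 : ℝ) / (K ^ 10 * K ^ 9) ≤ 3 / (2 * K ^ 10) := by
    rw [div_le_div_iff₀ (by positivity) (by positivity)]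
    nlinarith [hK10]
  have h7 : (6 : ℝ) / (K ^ 10 * K ^ 10) = 2 / (K ^ 10 * K ^ 10) + 4 / (K ^ 10 * K ^ 10) := by
    ring
  have h8 : (0 : ℝ) ≤ 2 / (K ^ 10 * K ^ 10) := by positivity
  linarith

/-! ## §126 The second ignition of a lattice dud: part 18 re-entered at `s₀ = r₁` -/

/-- **THE SECOND IGNITION OF A LATTICE DUD.** `K ≥ 16`, `0 < ε`, `ε² ≤ 1/(6K²⁰)`, an exact
trajectory of `rotorCircuit K K¹⁰ ε ρ` from (5.6) with `200ε/K²⁰ ≤ ρ² ≤ 2ε/K¹⁰` ON THE LATTICE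
`ε = kK¹⁰ρ²`: there are a re-light time `r₁ ∈ (t₋ + 2.8282, t₊ + 2.8542)` (part 38) and a SECOND
DOUSING TIME `T₂` with `r₁ < T₂`, `T₂ - r₁ ≤ 242/K⁹`, the trigger lit and `b² + c² ≥ (7ε/10)²` on
`[r₁, T₂]`, `b(r₁) ≥ 1.39ε`, `c(r₁) = ρ²/K⁹`, `b(T₂) ≤ -ε/4`, `c(T₂) ≤ 2ρ²/K¹⁰`,
`a(r₁)² ≥ 0.993`, `ã(T₂) ≤ ã(r₁) + K(T₂ - r₁)` — part 18's `knob_pulse_window` at `s₀ = r₁`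
with `H = 1/16`, `β = ε/4`, `ϱ = 7ε/10`, `γ = 13ε/20`, `λ₁ = λ = K⁻¹⁰` and §125's budget.
[cite: Tao2016AveragedNS, §5.5 Theorem 5.3, (5.5), (5.6), (b-eq), (c-eq), (tcable)] -/
theorem knob_dud_second_ignition
    (hX : ∀ t, HasDerivAt X (RotorKnob.rotorCircuit K (K ^ 10) ε ρ (X t)) t)
    (h0 : X 0 = delayInit) (hC : ∀ t, HasDerivAt C (X t 2) t) (hK : 16 ≤ K) (hε : 0 < ε)
    (hεK : ε ^ 2 ≤ 1 / (6 * K ^ 20)) (hρ : 0 < ρ) (hlo : 200 * ε / K ^ 20 ≤ ρ ^ 2)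
    (hhi : K ^ 10 * ρ ^ 2 ≤ 2 * ε) (k : ℕ) (hk : ε = k * K ^ 10 * ρ ^ 2) :
    ∃ r₁ T₂ : ℝ, √(2 - 24 * Real.log K / K ^ 10) + 28282 / 10000 < r₁ ∧
      r₁ < √(2 + 2 / K ^ 10) + 242 / K ^ 9 + 28542 / 10000 ∧ r₁ < T₂ ∧
      T₂ - r₁ ≤ 242 / K ^ 9 ∧
      (∀ t ∈ Icc r₁ T₂, 0 < X t 2) ∧
      (∀ t ∈ Icc r₁ T₂, (7 / 10 * ε) ^ 2 ≤ X t 1 ^ 2 + X t 2 ^ 2) ∧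
      139 / 100 * ε ≤ X r₁ 1 ∧ X r₁ 2 = ρ ^ 2 / K ^ 9 ∧ X T₂ 1 ≤ -(ε / 4) ∧
      X T₂ 2 ≤ (1 / K ^ 10 + 4 * exp (-K ^ 10) / K ^ 10) * ρ ^ 2 ∧
      993 / 1000 ≤ X r₁ 0 ^ 2 ∧ X T₂ 4 ≤ X r₁ 4 + K * (T₂ - r₁) := by
  have hK0 : 0 < K := by linarith
  have hK9 : 0 < K ^ 9 := by positivity
  have hK10 : 0 < K ^ 10 := by positivity
  have hρ2 : 0 < ρ ^ 2 := by positivity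
  have hε2 : 0 < ε ^ 2 := by positivity
  have h9 : (68719476736 : ℝ) ≤ K ^ 9 := by
    have := headline_pow_floor hK 9; norm_num at this; exact this
  have h10 : (1099511627776 : ℝ) ≤ K ^ 10 := by
    have := headline_pow_floor hK 10; norm_num at this; exact this
  obtain ⟨-, -, -, -, -, -, hρε, -⟩ := refire_window_facts hK hε hεK hhi
  -- part 38: the first dousing time `T`, the clock's zero `tz`, the re-light time `r₁`
  obtain ⟨T, tz, r₁, hT1, hT2, -, -, htz1, htz2, -, -, -, hr1, hr2, hcr₁, hpost⟩ :=
    knob_dud_refires_sharp hX h0 hC hK hε hεK hρ hlo hhi k hk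
  have hT0 : 0 ≤ T := le_trans (Real.sqrt_nonneg _) hT1
  have hr₁0 : 0 ≤ r₁ := by linarith
  obtain ⟨-, hb1, ha1⟩ := hpost r₁ ⟨by linarith, le_rfl⟩
  -- the clock is re-armed: `b(r₁) ≥ 0.993ε(r₁ - tz) ≥ 0.993·1.404·ε ≥ 1.39ε`
  have hb139 : 139 / 100 * ε ≤ X r₁ 1 := by
    have h1 : (1404 : ℝ) / 1000 ≤ r₁ - tz := by linarith
    have h2 := mul_le_mul_of_nonneg_left h1 (by positivity : (0:ℝ) ≤ 993 / 1000 * ε)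
    linarith
  -- the entry time is at most `4.4`: `√(2 + 2/K¹⁰) ≤ 3/2`, `242/K⁹ ≤ 10⁻²`
  have hsq : √(2 + 2 / K ^ 10) ≤ 3 / 2 := by
    have h2 : 2 / K ^ 10 ≤ 2 / 1099511627776 :=
      div_le_div_of_nonneg_left (by norm_num) (by norm_num) h10
    exact (Real.sqrt_le_left (by norm_num)).2 (by linarith)
  have h242 : (242 : ℝ) / K ^ 9 ≤ 242 / 68719476736 :=
    div_le_div_of_nonneg_left (by norm_num) (by norm_num) h9
  have hr44 : r₁ ≤ 44 / 10 := by linarith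
  -- part 18 at `s₀ = r₁`: `H = 1/16`, `β = ε/4`, `ϱ = 7ε/10`, `γ = 13ε/20`, `λ₁ = λ = K⁻¹⁰`
  have hKε : 1099511627776 * ε ^ 2 ≤ K ^ 10 * ε ^ 2 := mul_le_mul_of_nonneg_right h10 hε2.le
  have hγε : ε ^ 2 < K ^ 10 * (13 / 20 * ε) ^ 2 := by
    rw [show K ^ 10 * (13 / 20 * ε) ^ 2 = 169 / 400 * (K ^ 10 * ε ^ 2) by ring]
    linarith only [hKε, hε2]
  have hγϱ : (13 / 20 * ε) ^ 2 + (ε / 4) ^ 2 ≤ (7 / 10 * ε) ^ 2 := by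
    rw [show (13 / 20 * ε) ^ 2 + (ε / 4) ^ 2 = 97 / 200 * ε ^ 2 by ring,
      show (7 / 10 * ε) ^ 2 = 49 / 100 * ε ^ 2 by ring]
    linarith only [hε2]
  have harm : (7 / 10 * ε) ^ 2 + 2 * ε ^ 2 * ((r₁ + 1 / 16) ^ 2 - r₁ ^ 2) ≤
      X r₁ 1 ^ 2 + X r₁ 2 ^ 2 := by
    have hb2 : (139 / 100 * ε) * (139 / 100 * ε) ≤ X r₁ 1 * X r₁ 1 :=
      mul_self_le_mul_self (by positivity) hb139
    have hs : ε ^ 2 * r₁ ≤ ε ^ 2 * (44 / 10) := mul_le_mul_of_nonneg_left hr44 hε2.le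
    nlinarith [sq_nonneg (X r₁ 2), hb2, hs]
  have hu₁ : 1 / K ^ 10 * ρ ^ 2 ≤ X r₁ 2 := by
    rw [hcr₁, show 1 / K ^ 10 * ρ ^ 2 = ρ ^ 2 / K ^ 10 by ring]
    exact div_le_div_of_nonneg_left hρ2.le hK9
      (pow_le_pow_right₀ (by linarith : (1:ℝ) ≤ K) (by norm_num : 9 ≤ 10))
  have hbud := second_budget hK hε hρ hlo hr₁0 hr44
  have hH : (242 : ℝ) / K ^ 9 < 1 / 16 := by linarith
  obtain ⟨t₁, t₂, T₂, h01, h12, h2T, hTΔ, hTH, -, -, -, -, hdead, hcT, harmw, hcpos⟩ :=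
    knob_pulse_window hX h0 hε hρ hρε hK10 hr₁0 (by norm_num : (0:ℝ) < 1 / 16)
      (by positivity : (0:ℝ) < ε / 4) (by linarith) (by positivity : (0:ℝ) ≤ 13 / 20 * ε)
      hγϱ hγε harm hu₁ (by positivity : (0:ℝ) < 1 / K ^ 10) le_rfl (lt_of_le_of_lt hbud hH)
  have hsT : r₁ < T₂ := by linarith
  have hcT' : X T₂ 2 ≤ (1 / K ^ 10 + 4 * exp (-K ^ 10) / K ^ 10) * ρ ^ 2 := by
    rw [show ε * exp (-K ^ 10) / (K ^ 10 * (ε / 4)) = 4 * exp (-K ^ 10) / K ^ 10 by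
      rw [div_eq_div_iff (by positivity) hK10.ne']; ring] at hcT
    exact hcT
  refine ⟨r₁, T₂, by linarith, by linarith, hsT, hTΔ.trans hbud,
    fun t ht => hcpos t ⟨ht.1, by linarith [ht.2]⟩,
    fun t ht => harmw t ⟨ht.1, by linarith [ht.2]⟩, hb139, hcr₁,
    hdead T₂ ⟨h2T, hTH.le⟩, hcT', ha1, knob_output_growth hX h0 hK0.le hsT.le⟩

end Summit.NavierStokesRegularity.FluidComputer.GateBudget
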